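import Literature.Geometry.DiscreteGeometry.KissingFanTriangleSets
import Mathlib.Analysis.Normed.Module.Connected
import HarnessLib

/-!
# The facets (and the fan triangles) of the hull of a spherical code connect all its points

Topic `Literature/Geometry/DiscreteGeometry`.  For a finite set `X` of unit vectors of `ℝ³`
with `0 ∈ interior (conv X)`, the boundary complex of `conv X` is a subdivision of the SPHERE,
and the sphere is connected; consequently no proper nonempty subset of `X` can be closed under
"lying on a common facet".  This is the one GLOBAL (topological) property of the fan-refined
hull triangulation (`KissingFanTriangleSets.lean`) that a finite enumeration of its local
structure needs besides the local axioms (two triangles per side, node equations, counts):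
without it, two copies of the antipodal quotient of the cuboctahedron would satisfy every local
axiom of a kissing configuration.

* `tightSet_inter_nonempty_of_mem_argmaxCone`: a NONZERO point common to the cones over two
  facets forces a common tight point (the point lies over the hull of the common tight points:
  `argmaxCone_facetNormals_eq` and `mem_convexHull_tightSet`);
* **`eq_of_facet_closed`**: a nonempty `D ⊆ X` such that every facet meeting `D` has all its
  vertices in `D` is all of `X` (the unit sphere is covered by the closed cones over the facets
  inside `D` and over the facets disjoint from `D`, which do not meet on the sphere;
  `isPreconnected_sphere`);
* **`eq_of_fanTriSets_closed`**: the same with "facet" replaced by "fan triangle" (inside a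
  facet the fan triangles all contain the apex `w 0`).

Everything is PROVED; no named facts.

## References
* M. Balinski, *On the graph structure of convex polyhedra in n-space*, Pacific J. Math. 11
  (1961) (connectivity of polytope skeleta) — here only connectedness, via the sphere. [folklore]
* A.-M. Legendre, *Éléments de géométrie* (1794), VII (the spherical subdivision). [folklore]
-/

noncomputable section

namespace Literature.Geometry.DiscreteGeometry

open Real RealInnerProductSpace Finset

section HullConnected

local notation "E3" => EuclideanSpace ℝ (Fin 3)

variable {X : Finset E3}

/-! ### Part A. Two facet cones meet over the common tight points -/

/-- **A nonzero point common to the cones over two facets forces a common vertex**: if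
`x ≠ 0` lies in `argmaxCone F c ∩ argmaxCone F c'` (`F` the facet normals) then
`tightSet X c ∩ tightSet X c'` is nonempty — `x = t • p` with `t > 0` and `p` in the face of
`conv (tightSet X c)` cut out by `⟪c', ·⟫ = 1`, the hull of the common tight points.
[folklore] -/
theorem tightSet_inter_nonempty_of_mem_argmaxCone
    (h0 : (0 : E3) ∈ interior (convexHull ℝ (X : Set E3))) {c c' : E3}
    (hc : c ∈ facetNormals X) (hc' : c' ∈ facetNormals X) {x : E3} (hx0 : x ≠ 0)
    (hx : x ∈ argmaxCone (facetNormals X) c) (hx' : x ∈ argmaxCone (facetNormals X) c') :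
    (tightSet X c ∩ tightSet X c').Nonempty := by
  rw [argmaxCone_facetNormals_eq h0 hc] at hx
  obtain ⟨t, ht, p, hp, rfl⟩ := hx
  have htpos : 0 < t := by
    rcases ht.eq_or_lt with h | h
    · exact absurd (by rw [← h, zero_smul]) hx0
    · exact h
  have hpX : p ∈ convexHull ℝ (X : Set E3) :=
    convexHull_mono (Finset.coe_subset.2 (tightSet_subset X c)) hp
  have hcF := mem_facetNormals.1 hc
  have hc'F := mem_facetNormals.1 hc'
  have hp1 : ⟪c, p⟫ = 1 := by
    refine le_antisymm (inner_le_one_of_mem_convexHull hcF.1 hpX) ?_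
    have h := inner_le_of_mem_convexHull (X := ((tightSet X c : Finset E3) : Set E3)) (c := -c)
      (m := -1) (fun y hy => by
        rw [inner_neg_left, (mem_tightSet.1 (Finset.mem_coe.1 hy)).2]) hp
    rw [inner_neg_left] at h
    linarith
  have hp1' : ⟪c', p⟫ = 1 := by
    refine le_antisymm (inner_le_one_of_mem_convexHull hc'F.1 hpX) ?_
    have h := hx' c hc
    rw [real_inner_smul_right, real_inner_smul_right, hp1, mul_one] at h
    by_contra hlt
    rw [not_le] at hlt
    have : t * ⟪c', p⟫ < t * 1 := mul_lt_mul_of_pos_left hlt htpos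
    linarith
  have h := mem_convexHull_tightSet (X := tightSet X c) (c := c')
    (fun y hy => hc'F.1 y (tightSet_subset X c hy)) hp hp1'
  have hset : tightSet (tightSet X c) c' = tightSet X c ∩ tightSet X c' := by
    ext y
    simp only [mem_tightSet, Finset.mem_inter]
    tauto
  rw [hset] at h
  by_contra hemp
  rw [Finset.not_nonempty_iff_eq_empty] at hemp
  rw [hemp, Finset.coe_empty, convexHull_empty] at h
  exact h

/-! ### Part B. A facet-closed nonempty set of points is everything -/

/-- **A nonempty facet-closed subset of `X` is all of `X`.**  If `D ⊆ X` is nonempty and every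
facet with a vertex in `D` has all its vertices in `D`, then `D = X`: the unit sphere is the
union of its intersections with the (closed) cones over the facets inside `D` and over the
facets disjoint from `D`; these two closed sets do not meet on the sphere (Part A), the first
is nonempty, so by connectedness of `S²` the second family is empty, and every point of `X`
lies on a facet. [folklore] -/
theorem eq_of_facet_closed (hX1 : ∀ y ∈ X, ‖y‖ = 1)
    (h0 : (0 : E3) ∈ interior (convexHull ℝ (X : Set E3))) {D : Finset E3} (hDX : D ⊆ X)
    (hD : D.Nonempty)
    (hcl : ∀ c ∈ facetNormals X, ∀ y ∈ tightSet X c, y ∈ D → tightSet X c ⊆ D) : D = X := by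
  classical
  -- the two families of facets
  set FD := (facetNormals X).filter fun c => tightSet X c ⊆ D with hFD
  set FR := (facetNormals X).filter fun c => ¬ tightSet X c ⊆ D with hFR
  have hdisj : ∀ c ∈ FR, ∀ y ∈ tightSet X c, y ∉ D := by
    intro c hc y hy hyD
    rw [hFR, Finset.mem_filter] at hc
    exact hc.2 (hcl c hc.1 y hy hyD)
  -- the two closed sets
  set U : Set E3 := ⋃ c ∈ FD, argmaxCone (facetNormals X) c with hU
  set V : Set E3 := ⋃ c ∈ FR, argmaxCone (facetNormals X) c with hV
  have hUc : IsClosed U := by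
    rw [hU]
    exact Set.Finite.isClosed_biUnion FD.finite_toSet fun c _ => isClosed_argmaxCone _ _
  have hVc : IsClosed V := by
    rw [hV]
    exact Set.Finite.isClosed_biUnion FR.finite_toSet fun c _ => isClosed_argmaxCone _ _
  set S : Set E3 := Metric.sphere (0 : E3) 1 with hS
  have hcover : S ⊆ U ∪ V := by
    intro z _
    obtain ⟨c, hc, hz⟩ := exists_mem_argmaxCone (facetNormals X) (facetNormals_nonempty h0) z
    by_cases h : tightSet X c ⊆ D
    · left
      rw [hU]; simp only [Set.mem_iUnion]
      exact ⟨c, Finset.mem_filter.2 ⟨hc, h⟩, hz⟩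
    · right
      rw [hV]; simp only [Set.mem_iUnion]
      exact ⟨c, Finset.mem_filter.2 ⟨hc, h⟩, hz⟩
  -- a point of `X` is on the sphere and in the cone of every facet containing it
  have hmemS : ∀ y ∈ X, y ∈ S := fun y hy => by
    rw [hS, mem_sphere_zero_iff_norm]; exact hX1 y hy
  have hmemCone : ∀ c ∈ facetNormals X, ∀ y ∈ tightSet X c, y ∈ argmaxCone (facetNormals X) c := by
    intro c hc y hy c'' hc''
    rw [(mem_tightSet.1 hy).2]
    exact (mem_facetNormals.1 hc'').1 y (mem_tightSet.1 hy).1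
  -- `S ∩ U` is nonempty
  have hSU : (S ∩ U).Nonempty := by
    obtain ⟨y, hy⟩ := hD
    obtain ⟨c, hc⟩ := exists_mem_facetsAt hX1 h0 (hDX hy)
    obtain ⟨hcF, hyc⟩ := mem_facetsAt.1 hc
    refine ⟨y, hmemS y (hDX hy), ?_⟩
    rw [hU]; simp only [Set.mem_iUnion]
    exact ⟨c, Finset.mem_filter.2 ⟨hcF, hcl c hcF y hyc hy⟩, hmemCone c hcF y hyc⟩
  -- `S ∩ (U ∩ V)` is empty
  have hSUV : ¬(S ∩ (U ∩ V)).Nonempty := by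
    rintro ⟨z, hzS, hzU, hzV⟩
    rw [hU] at hzU; rw [hV] at hzV
    simp only [Set.mem_iUnion] at hzU hzV
    obtain ⟨c, hc, hzc⟩ := hzU
    obtain ⟨c', hc', hzc'⟩ := hzV
    have hz0 : z ≠ 0 := by
      intro h
      rw [h, hS, mem_sphere_zero_iff_norm, norm_zero] at hzS
      exact zero_ne_one hzS
    obtain ⟨y, hy⟩ := tightSet_inter_nonempty_of_mem_argmaxCone h0 (Finset.mem_filter.1 hc).1
      (Finset.mem_filter.1 hc').1 hz0 hzc hzc'
    rw [Finset.mem_inter] at hy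
    exact hdisj c' hc' y hy.2 ((Finset.mem_filter.1 hc).2 hy.1)
  -- connectedness of the sphere: `S ∩ V` must be empty
  have hrank : 1 < Module.rank ℝ E3 := by
    rw [← Module.finrank_eq_rank, finrank_euclideanSpace_fin]
    norm_num
  have hpre : IsPreconnected S := isPreconnected_sphere hrank (0 : E3) 1
  have hSV : ¬(S ∩ V).Nonempty := fun hSV =>
    hSUV ((isPreconnected_closed_iff.1 hpre) U V hUc hVc hcover hSU hSV)
  -- hence no facet is disjoint from `D`, and every point lies on a facet
  have hFR0 : FR = ∅ := by
    by_contra hne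
    obtain ⟨c, hc⟩ := Finset.nonempty_iff_ne_empty.2 hne
    have hcF := (Finset.mem_filter.1 hc).1
    obtain ⟨y, hy⟩ : (tightSet X c).Nonempty := by
      rw [← Finset.card_pos]; have := three_le_card_tightSet hcF; omega
    exact hSV ⟨y, hmemS y (tightSet_subset X c hy), by
      rw [hV]; simp only [Set.mem_iUnion]; exact ⟨c, hc, hmemCone c hcF y hy⟩⟩
  refine Finset.Subset.antisymm hDX fun y hy => ?_
  obtain ⟨c, hc⟩ := exists_mem_facetsAt hX1 h0 hy
  obtain ⟨hcF, hyc⟩ := mem_facetsAt.1 hc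
  have hsub : tightSet X c ⊆ D := by
    by_contra hns
    have : c ∈ FR := Finset.mem_filter.2 ⟨hcF, hns⟩
    rw [hFR0] at this
    exact Finset.notMem_empty _ this
  exact hsub hyc

/-! ### Part C. The fan triangles connect all points -/

/-- Every vertex of a facet lies in a fan triangle of that facet together with the apex `w 0`.
[folklore] -/
theorem exists_fanTriangle_with_apex (hX1 : ∀ y ∈ X, ‖y‖ = 1) {c : E3} (hc : c ∈ facetNormals X)
    {y : E3} (hy : y ∈ tightSet X c) :
    ∃ i, (c, i) ∈ fanTriangles X ∧ y ∈ fanVerts X (c, i) ∧ fVert X c 0 ∈ fanVerts X (c, i) := by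
  have hc0 := ne_zero_of_mem_facetNormals hX1 hc
  have hm : 3 ≤ (tightSet X c).card := three_le_card_tightSet hc
  obtain ⟨j, hj, hjy⟩ := exists_facetVertex_eq hX1 hc0 hy
  rw [card_facetAngles hX1 hc0] at hj
  rw [← fVert_eq hc0] at hjy
  subst hjy
  have apex : ∀ i, fVert X c 0 ∈ fanVerts X (c, i) := fun i => by
    unfold fanVerts; exact Finset.mem_insert_self _ _
  by_cases hj0 : j = 0
  · refine ⟨0, mem_fanTriangles.2 ⟨hc, by simp only; omega⟩, ?_, apex 0⟩
    rw [hj0]; exact apex 0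
  · by_cases hjl : j + 1 < (tightSet X c).card
    · refine ⟨j - 1, mem_fanTriangles.2 ⟨hc, by simp only; omega⟩, ?_, apex _⟩
      unfold fanVerts
      simp only [Finset.mem_insert, Finset.mem_singleton]
      right; left; congr 1; omega
    · refine ⟨j - 2, mem_fanTriangles.2 ⟨hc, by simp only; omega⟩, ?_, apex _⟩
      unfold fanVerts
      simp only [Finset.mem_insert, Finset.mem_singleton]
      right; right; congr 1; omega

/-- **A nonempty subset of `X` closed under "sharing a fan triangle" is all of `X`.**
(Inside a facet every vertex shares a fan triangle with the apex `w 0`, so triangle-closure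
implies facet-closure, and `eq_of_facet_closed` applies.) [folklore] -/
theorem eq_of_fanTriSets_closed (hX1 : ∀ y ∈ X, ‖y‖ = 1)
    (h0 : (0 : E3) ∈ interior (convexHull ℝ (X : Set E3))) {D : Finset E3} (hDX : D ⊆ X)
    (hD : D.Nonempty) (hcl : ∀ t ∈ fanTriSets X, ∀ y ∈ t, y ∈ D → t ⊆ D) : D = X := by
  refine eq_of_facet_closed hX1 h0 hDX hD fun c hc y hy hyD z hz => ?_
  -- `y` shares a fan triangle with the apex, and so does `z`
  obtain ⟨i, hi, hyi, h0i⟩ := exists_fanTriangle_with_apex hX1 hc hy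
  obtain ⟨k, hk, hzk, h0k⟩ := exists_fanTriangle_with_apex hX1 hc hz
  have hti : fanVerts X (c, i) ∈ fanTriSets X := mem_fanTriSets.2 ⟨(c, i), hi, rfl⟩
  have htk : fanVerts X (c, k) ∈ fanTriSets X := mem_fanTriSets.2 ⟨(c, k), hk, rfl⟩
  have h0D : fVert X c 0 ∈ D := hcl _ hti y hyi hyD h0i
  exact hcl _ htk _ h0k h0D hzk

end HullConnected

end Literature.Geometry.DiscreteGeometry

end
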